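import Literature.AlgebraicGeometry.Resolution.LogRefinedChartRegular
import Literature.AlgebraicGeometry.Resolution.LogBlowupOrthant
import Literature.AlgebraicGeometry.Resolution.LogRegularBlowupCriterion
import HarnessLib

/-!
# Kato 1994, (10.4), one chart: log regular affine schemes are resolved — PROOF of the named fact

`Literature/AlgebraicGeometry/Resolution/LogRegularResolutionHolds.lean`. Discharge of the named
fact `Kato1994_logRegular_hasResolution` (`LogRegularResolution.lean`): for a Noetherian ring `A`
with ONE fs chart `φ : P → A` (`P ⊆ ℤⁿ` finitely generated, saturated, spanning) that is log
regular at every prime (Kato Def. (2.1)), `Spec A` has a resolution of singularities. Proof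
(K. Kato, *Toric singularities*, Amer. J. Math. 116 (1994), (9.8), (10.3), (10.4), in the
un-normalised blow-up form): take a regular projective subdivision of `P^∨` with a strictly convex
integral support function ([KKMS] I Thm. 11, `Fan.exists_regular_refinement_isStrictSupport`), let
`s ⊆ P` generate the degree-`k` piece of its section monoid at a Veronese degree `k`
(`LogBlowup.exists_finset_isOrthantLike_blowupChartMonoid`: every chart monoid `P⟨s − a⟩` is
`ℕ^I ⊕ ℤ^{Iᶜ}`), and blow up the ideal `(φ(s))`: the blow-up is proper and birational
(`Kato1994_logRegular_hasResolution_of_charts`, res-type-037) and its charts `A[φ(s)/φ(a)]`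
are regular by Kato (10.3) (`LogRefinedChart.isRegularLocalRing_localization_chartAlgebra`, the
identification with the refined chart rings of `LogRegularRefinement*.lean`).

* `blowupAlgebra_hΩ` — maps `A → L` into fields inverting `φ(P)` extend to `A[I/φ(a)]`;
* `Kato1994_logRegular_hasResolution_holds` — THE THEOREM.

References: [Kato1994] (9.8), (10.3), (10.4); [KempfEtAl1973] Ch. I §2 Thm. 11; [Niziol2006] Thm. 5.8.
-/

noncomputable section

namespace Literature.AlgebraicGeometry.Resolution

universe u

/-- A map `A → L` into a field sending `φ(a)` to a non-zero element extends to the blow-up chart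
algebra `A[I/φ(a)] ⊆ A[φ(a)⁻¹]`. [cite: Kato1994, (10.3)] -/
theorem blowupAlgebra_exists_extend {A : Type u} [CommRing A] (I : Ideal A) (x : A)
    (L : Type u) [Field L] (g : A →+* L) (hx : g x ≠ 0) :
    ∃ ω : blowupAlgebra I x →+* L, ω.comp (algebraMap A (blowupAlgebra I x)) = g := by
  have hu : IsUnit (g x) := isUnit_iff_ne_zero.2 hx
  refine ⟨(IsLocalization.Away.lift x hu).comp (blowupAlgebra I x).val.toRingHom, ?_⟩
  ext a
  simp only [RingHom.coe_comp, Function.comp_apply, AlgHom.toRingHom_eq_coe, RingHom.coe_coe,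
    Subalgebra.coe_val]
  rw [Subalgebra.coe_algebraMap, IsLocalization.Away.lift_eq]

/-- **Kato 1994, (10.4), the one-chart affine case — PROVED.** For a Noetherian ring `A`, a
finitely generated, saturated, spanning `P ⊆ ℤⁿ` and a chart `φ : P → A` log regular at every
prime, `Spec A` admits a resolution of singularities (the blow-up of the ideal `(φ(s))` for the
monoid ideal generators `s` of a regular projective subdivision of `P^∨`; Kato (9.8), (10.3),
(10.4); [KKMS] I Thm. 11; Nizioł 2006 Thm. 5.8). [cite: Kato1994, (10.4)] -/
theorem Kato1994_logRegular_hasResolution_holds : Kato1994_logRegular_hasResolution.{u} := by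
  refine Kato1994_logRegular_hasResolution_of_charts fun A _ _ n P φ hP hsat hspan hreg => ?_
  obtain ⟨s, hs, hcharts⟩ := LogBlowup.exists_finset_isOrthantLike_blowupChartMonoid P hP hsat hspan
  refine ⟨s, hs, fun a ha 𝔓 _ => ?_⟩
  obtain ⟨b, I, hQ⟩ := hcharts a ha
  exact LogRefinedChart.isRegularLocalRing_localization_chartAlgebra hP hsat hspan
    (fun 𝔭 _ => hreg 𝔭) hQ (LogChart.le_blowupChartMonoid P (↑s) a) (LogChart.blowupChart P φ (↑s) a)
    (fun p => LogChart.blowupChart_of_mem P φ (↑s) a p)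
    (LogChart.adjoin_range_blowupChart_eq_top P φ (↑s) a)
    (fun L _ g hg => blowupAlgebra_exists_extend _ _ L g (hg a)) 𝔓

end Literature.AlgebraicGeometry.Resolution
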